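import Mathlib
import HarnessLib
import Summits.NavierStokesRegularity.NavierStokesRegularity.Theorems.PoloidalWindowDoorLrcModEntireQ4SonicHotSheetJet
import Summits.NavierStokesRegularity.NavierStokesRegularity.Theorems.PoloidalWindowDoorLrcModEntireQ4SonicHotSheetNormalForm
import Summits.NavierStokesRegularity.NavierStokesRegularity.Theorems.PoloidalWindowDoorPoloidalWindowRigidityTimeHeightShearWeight
import Literature.Analysis.FluidPDE.FirstIntegralTransportDefect

/-!
# Route `PoloidalWindowDoor`, item `LrcModEntire` (stmt-NavierStokesRegularity-20428), cell (Q4-sonic), slot `stub_Q4sonicLineNeg` —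
# B-SPEED, I: THE NORMAL DERIVATIVE OF THE LAPLACIAN ON THE STRAIGHT SONIC SHEET, `D(Δθ)(W)[Je] = (1 + d′²)·D³θ(W)[Je,Je,Je]`

Cell ns-regularity-ideate, helper seat ns-k2-port-2 g8 under the LEAD of item 20428 (ns-poloidal-K2-p3 g17, memo `T2B-g17.md` §4 «B-SPEED … port-2»);
`--supports stmt-NavierStokesRegularity-20428 --as helper`.  First half of the sonic evaluation of the web-speed law (memo `HOT-SHEET-port2g8.md` (3a), T2B-g17 (2c)):
on the straight sonic sheet `W(s,z) = s·e + d(z)·Je + z·e₂` both sheet tangents `e`, `T(z) = d′(z)Je + e₂` are null for `D²θ(W)` (`…SecondPins`), `D³θ(W)[e,·,·] = 0`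
(`…Jet`), and the transport law `∂_z(d′·a²) = 0` holds (`…SheetTransport`, `a(z) = D²θ(W)[Je,Je] ≠ 0`).  Differentiating the null tangent `T(z)` along the sheet
and taking the trace:

* `hasDerivAt_hessian_along` (class-free) — `z ↦ D²θ(W(z))[u,w]` has derivative `D³θ(W(z))[W′(z)][u][w]`;
* ★ `laplacian_normalDeriv_of_sonicSheet` (class-free) — `θ ∈ C³`, `e` horizontal unit, `d ∈ C²` near `z`, `T(z′)` null for `D²θ(W(s,z′))` for `z′` near `z`,
  `D³θ(W)[e,e,Je] = 0`, transport `HasDerivAt (z′ ↦ d′(z′)·a(z′)²) 0 z`, `a(z) ≠ 0` ⇒ **`D(Δθ)(W(s,z))[Je] = (1 + d′(z)²)·D³θ(W(s,z))[Je,Je,Je]`**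
  (the entries `D³θ[e₂,Je,Je] = a′ − d′a₃`, `D³θ[e₂,e₂,Je] = d′²a₃ − 2d′a′ − d″a`, and `2d′a′ + d″a = 0`; `a₃ := D³θ[Je,Je,Je]`).

Part II (class level: the `Je`-derivative of K2-p2 g4's `…TimeHeightShearWeight.horizFDeriv_weightSource_eq_zero` at a sheet point and the assembly
`∂_ν(∂ₜU₂)(−1,W) = (1+d′²)a₃ − a·(U·Je − d′N) + 2d′a·μ_z/(1−μ)`) is the companion file `…Q4SonicSheetSpeedClass`.
WHAT THIS IS NOT: not a claim about Navier–Stokes regularity — calculus on the hypothetical hot null sheet of the research slot `stub_Q4sonicLineNeg` (registry twist_split v12);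
no stub is closed here; items 20428 / 19708 / 27893 OPEN.
-/

noncomputable section

set_option linter.dupNamespace false
set_option linter.style.longLine false

namespace Summit.NavierStokesRegularity.NavierStokesRegularity.Theorems.PoloidalWindowDoorLrcModEntireQ4SonicSheetSpeed

open Set Function Filter Topology Metric
open scoped RealInnerProductSpace InnerProductSpace Laplacian ContDiff
open Literature.Analysis Literature.Analysis.FluidPDE
open Summit.NavierStokesRegularity.NavierStokesRegularity.Theorems
open Summit.NavierStokesRegularity.NavierStokesRegularity.Theorems.PoloidalWindowDoorLrcModEntireSheetFlattenTools
open Summit.NavierStokesRegularity.NavierStokesRegularity.Theorems.PoloidalWindowDoorLrcModEntireTwistingTHFlatRidgeThirdJet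
open Summit.NavierStokesRegularity.NavierStokesRegularity.Theorems.PoloidalWindowDoorLrcModEntireQ4SonicHotSheetJet
open Literature.Analysis.FluidPDE

/-! ### Class-free calculus on the straight sheet `W(z) = s·e + d(z)·Je + z·e₂` (fixed `s`) -/

section ClassFree

variable {θ : EuclideanSpace ℝ (Fin 3) → ℝ} {e : EuclideanSpace ℝ (Fin 3)} {d : ℝ → ℝ} {s : ℝ}

/-- The web line in `z` at fixed `s`: `z ↦ s·e + d(z)·Je + z·e₂` has derivative `d′(z)·Je + e₂`. -/
theorem hasDerivAt_webLine {z d' : ℝ} (hd : HasDerivAt d d' z) :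
    HasDerivAt (fun z' : ℝ => s • e + d z' • Jvec e + z' • e2) (d' • Jvec e + e2) z := by
  have h1 : HasDerivAt (fun z' : ℝ => s • e + d z' • Jvec e) (d' • Jvec e) z := (hd.smul_const (Jvec e)).const_add (s • e)
  have h2 : HasDerivAt (fun z' : ℝ => z' • e2) ((1 : ℝ) • e2) z := (hasDerivAt_id z).smul_const e2
  exact (h1.fun_add h2).congr_deriv (by rw [one_smul])

/-- **`z ↦ D²θ(W(z))[u][w]` has derivative `D³θ(W(z))[W′(z)][u][w]`** for `θ ∈ C³`. -/
theorem hasDerivAt_hessian_along (hθ : ContDiff ℝ 3 θ) {z d' : ℝ} (hd : HasDerivAt d d' z) (u w : EuclideanSpace ℝ (Fin 3)) :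
    HasDerivAt (fun z' : ℝ => fderiv ℝ (fderiv ℝ θ) (s • e + d z' • Jvec e + z' • e2) u w)
      (fderiv ℝ (fderiv ℝ (fderiv ℝ θ)) (s • e + d z • Jvec e + z • e2) (d' • Jvec e + e2) u w) z := by
  have hθ2 : ContDiff ℝ 2 θ := hθ.of_le (by norm_num)
  -- the entry `x ↦ D²θ(x)[u][w]` as the derivative of the scalar function `g_w = ∂_wθ` in the direction `u`
  have hgw : ContDiff ℝ 2 (fun x => fderiv ℝ θ x w) := (hθ.fderiv_right (m := 2) (by norm_num)).clm_apply contDiff_const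
  have hDgw : Differentiable ℝ (fderiv ℝ (fun x => fderiv ℝ θ x w)) := (hgw.fderiv_right (m := 1) (by norm_num)).differentiable one_ne_zero
  have hfun : (fun x => fderiv ℝ (fderiv ℝ θ) x u w) = fun x => fderiv ℝ (fun x' => fderiv ℝ θ x' w) x u :=
    funext fun x => (nested_eq_fderiv_fderiv hθ2 x u w).symm
  have hφ : DifferentiableAt ℝ (fun x => fderiv ℝ (fderiv ℝ θ) x u w) (s • e + d z • Jvec e + z • e2) := by
    rw [hfun]; exact (hDgw _).clm_apply (differentiableAt_const u)
  have h := hφ.hasFDerivAt.comp_hasDerivAt z (hasDerivAt_webLine (e := e) (s := s) hd)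
  have hval : fderiv ℝ (fun x => fderiv ℝ (fderiv ℝ θ) x u w) (s • e + d z • Jvec e + z • e2) (d' • Jvec e + e2) =
      fderiv ℝ (fderiv ℝ (fderiv ℝ θ)) (s • e + d z • Jvec e + z • e2) (d' • Jvec e + e2) u w := by
    rw [hfun, fderiv_apply_const_apply_eq_fderiv_fderiv (hDgw _), fderiv_fderiv_fderiv_apply_eq hθ]
  rw [hval] at h
  exact h

/-- ★ **THE NORMAL DERIVATIVE OF THE LAPLACIAN ON THE STRAIGHT SONIC SHEET.**  `θ ∈ C³`; `e` a horizontal unit vector; the offset `d` differentiable near `z` with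
`d′` differentiable at `z`; the sheet tangent `T(z′) = d′(z′)Je + e₂` null for `D²θ(W(s,z′))` for `z′` near `z`; `D³θ(W)[e,e,Je] = 0`; the transport law
`(d′a²)′(z) = 0` with `a(z) = D²θ(W)[Je,Je] ≠ 0`.  Then `D(Δθ)(W(s,z))[Je] = (1 + d′(z)²)·D³θ(W(s,z))[Je,Je,Je]`. -/
theorem laplacian_normalDeriv_of_sonicSheet (hθ : ContDiff ℝ 3 θ) (he2 : e 2 = 0) (hunit : e 0 ^ 2 + e 1 ^ 2 = 1) {z d'' : ℝ}
    (hd : ∀ᶠ z' in 𝓝 z, DifferentiableAt ℝ d z') (hd2 : HasDerivAt (deriv d) d'' z)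
    (hnullT : ∀ᶠ z' in 𝓝 z, ∀ w, fderiv ℝ (fderiv ℝ θ) (s • e + d z' • Jvec e + z' • e2) (deriv d z' • Jvec e + e2) w = 0)
    (h3e : fderiv ℝ (fderiv ℝ (fderiv ℝ θ)) (s • e + d z • Jvec e + z • e2) e e (Jvec e) = 0)
    (htr : HasDerivAt (fun z' : ℝ => deriv d z' * (fderiv ℝ (fderiv ℝ θ) (s • e + d z' • Jvec e + z' • e2) (Jvec e) (Jvec e)) ^ 2) 0 z)
    (ha : fderiv ℝ (fderiv ℝ θ) (s • e + d z • Jvec e + z • e2) (Jvec e) (Jvec e) ≠ 0) :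
    fderiv ℝ (Δ θ) (s • e + d z • Jvec e + z • e2) (Jvec e) =
      (1 + deriv d z ^ 2) * fderiv ℝ (fderiv ℝ (fderiv ℝ θ)) (s • e + d z • Jvec e + z • e2) (Jvec e) (Jvec e) (Jvec e) := by
  set y := s • e + d z • Jvec e + z • e2 with hy
  set D3 := fderiv ℝ (fderiv ℝ (fderiv ℝ θ)) y with hD3
  set k := deriv d z with hk
  set a := fderiv ℝ (fderiv ℝ θ) y (Jvec e) (Jvec e) with ha_def
  have hθy : ContDiffAt ℝ 3 θ y := hθ.contDiffAt
  have h12 : ∀ u v w, D3 u v w = D3 v u w := fun u v w => thirdDeriv_symm₁₂ hθy u v w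
  have h23 : ∀ u v w, D3 u v w = D3 u w v := fun u v w => thirdDeriv_symm₂₃ hθy u v w
  have hdz : HasDerivAt d k z := hd.self_of_nhds.hasDerivAt
  -- the derivatives along the sheet of the Hessian entries
  set a' := D3 (k • Jvec e + e2) (Jvec e) (Jvec e) with ha'_def
  have hA : HasDerivAt (fun z' : ℝ => fderiv ℝ (fderiv ℝ θ) (s • e + d z' • Jvec e + z' • e2) (Jvec e) (Jvec e)) a' z :=
    hasDerivAt_hessian_along hθ hdz _ _
  have hB : HasDerivAt (fun z' : ℝ => fderiv ℝ (fderiv ℝ θ) (s • e + d z' • Jvec e + z' • e2) e2 (Jvec e)) (D3 (k • Jvec e + e2) e2 (Jvec e)) z :=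
    hasDerivAt_hessian_along hθ hdz _ _
  -- (α) differentiate the null tangent `z′ ↦ D²θ(W)[T(z′)][Je] = d′·D²θ[Je][Je] + D²θ[e₂][Je] ≡ 0`
  have hαfun : ∀ᶠ z' in 𝓝 z, deriv d z' * fderiv ℝ (fderiv ℝ θ) (s • e + d z' • Jvec e + z' • e2) (Jvec e) (Jvec e) +
      fderiv ℝ (fderiv ℝ θ) (s • e + d z' • Jvec e + z' • e2) e2 (Jvec e) = 0 := by
    filter_upwards [hnullT] with z' hz'
    have h := hz' (Jvec e)
    simpa [map_add, map_smul] using h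
  have hα : d'' * a + k * a' + D3 (k • Jvec e + e2) e2 (Jvec e) = 0 := by
    have hsum := (hd2.mul hA).add hB
    have hzero : HasDerivAt (fun z' : ℝ => deriv d z' * fderiv ℝ (fderiv ℝ θ) (s • e + d z' • Jvec e + z' • e2) (Jvec e) (Jvec e) +
        fderiv ℝ (fderiv ℝ θ) (s • e + d z' • Jvec e + z' • e2) e2 (Jvec e)) 0 z :=
      (hasDerivAt_const z (0 : ℝ)).congr_of_eventuallyEq hαfun
    have h := hsum.unique hzero
    rw [← hk, ← ha_def] at h
    linarith
  -- the transport law: `2k·a′ + d″·a = 0`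
  have htr' : d'' * a + 2 * k * a' = 0 := by
    have hsq := hd2.mul (hA.pow 2)
    have h := hsq.unique htr
    rw [← hk, ← ha_def] at h
    have h2 : a * (d'' * a + 2 * k * a') = 0 := by
      have : d'' * a ^ 2 + k * (↑2 * a ^ (2 - 1) * a') = 0 := h
      norm_num at this
      linear_combination this
    rcases mul_eq_zero.1 h2 with h3 | h3
    · exact absurd h3 ha
    · exact h3
  -- the entries in terms of `a₃ = D³θ[Je,Je,Je]`
  set a3 := D3 (Jvec e) (Jvec e) (Jvec e) with ha3
  have hE1 : D3 e2 (Jvec e) (Jvec e) = a' - k * a3 := by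
    have h : a' = k * a3 + D3 e2 (Jvec e) (Jvec e) := by
      rw [ha'_def, ha3]; simp only [map_add, map_smul, add_apply, smul_apply, smul_eq_mul]
    linarith
  have hE2 : D3 e2 e2 (Jvec e) = k ^ 2 * a3 - 2 * k * a' - d'' * a := by
    have h : D3 (k • Jvec e + e2) e2 (Jvec e) = k * D3 (Jvec e) e2 (Jvec e) + D3 e2 e2 (Jvec e) := by simp [map_add, map_smul]
    have h2 : D3 (Jvec e) e2 (Jvec e) = D3 e2 (Jvec e) (Jvec e) := by rw [h12]
    rw [h, h2, hE1] at hα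
    linear_combination hα
  -- the trace
  have htrace : fderiv ℝ (Δ θ) y (Jvec e) = D3 (Jvec e) e e + D3 (Jvec e) (Jvec e) (Jvec e) + D3 (Jvec e) e2 e2 := by
    rw [fderiv_laplacian_apply_eq_sum_thirdDeriv hθy (Jvec e), Fin.sum_univ_three]
    have hsw : ∀ i : Fin 3, D3 (EuclideanSpace.single i (1 : ℝ)) (EuclideanSpace.single i (1 : ℝ)) (Jvec e) =
        D3 (Jvec e) (EuclideanSpace.single i (1 : ℝ)) (EuclideanSpace.single i (1 : ℝ)) := by
      intro i; rw [h23, h12]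
    rw [hsw 0, hsw 1, hsw 2, ← bilin_frame_trace (D3 (Jvec e)) he2 hunit]
    rfl
  have hJee : D3 (Jvec e) e e = 0 := by rw [h12, h23]; exact h3e
  have hJ22 : D3 (Jvec e) e2 e2 = k ^ 2 * a3 - 2 * k * a' - d'' * a := by rw [h12, h23, h12]; exact hE2
  rw [htrace, hJee, hJ22]
  linear_combination (-1 : ℝ) * htr'

end ClassFree

end Summit.NavierStokesRegularity.NavierStokesRegularity.Theorems.PoloidalWindowDoorLrcModEntireQ4SonicSheetSpeed

end
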